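import Literature.NumberTheory.Automorphic.QuasiSplitUnitaryCartanTame
import Literature.NumberTheory.Automorphic.HyperspecialUnitaryCartanAdicCompletion
import Literature.NumberTheory.Rogawski1990.UnitaryVertexStabilizerSpanSelfDualTameRamifiedCM
import HarnessLib

/-!
# Cartan decomposition of `U(σ_w, J₀)(L_w)` at a TAMELY RAMIFIED non-split place of a CM field, and the place-level dock of the
# five bare binders `(hσ) (hvσ) (hϖ) (htrace) (hnorm)` (Tits 1979 §3.3.3; Serre, *Local Fields* V §3)

Topic `NumberTheory/Automorphic`; namespace `Literature.NumberTheory.Automorphic.UnitaryGroup`.  THEOREMS only; no definition, no instance,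
no notation, no named fact, no `sorry`.  The tame twin of ★ `HyperspecialUnitaryCartanAdicCompletion` (which docks ★ `LocalConjDatum` ∕ ★
`UnramifiedLocalConjDatum` at the UNRAMIFIED non-split places).

**The point.**  The any-uniformiser lattice road ★ `HermitianLatticesAdaptedPlaneTame` → ★ `QuasiSplitUnitaryCartanFramesTame` → ★
`QuasiSplitUnitaryCartanTame.exists_cartan_antidiagonal_of_trace_norm` proves the Cartan decomposition `U(σ, J₀)(K) = K₀ · T · K₀` under five bare
binders — `σ` an isometric involution, `ϖ` ANY uniformiser, (trace) `∃ t ∈ 𝒪, t + σ t = 1`, (norm) «`σ`-fixed principal units are norms with level».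
Here they are DISCHARGED at the places of a CM field `L ∕ L⁺` (`σ_w = galAdicCompletionMap (complexConj L) hw` on `L_w`, `w` the place over a non-split `v`):

* `exists_traceNorm_adicCompletion_of_ramified` — at a RAMIFIED place with `|2|_w = 1` (i.e. TAMELY ramified): a uniformiser `ϖ` with `σ_w ϖ = −ϖ`
  (★ `Rogawski1990.ramifiedBlock_adicCompletion` (R1)), (trace) with `t = 2⁻¹`, and (norm) (★ ibid., Hensel in `𝒪_w`).  [`hσ`, `hvσ` are ★
  `galAdicCompletionMap_galAdicCompletionMap_of_smul_eq` ∕ ★ `valued_galAdicCompletionMap` and are not restated.]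
* `exists_traceNorm_adicCompletion_of_isUnramifiedIn` — at an UNRAMIFIED non-split place (any quadratic `E ∕ F`, any residue characteristic) the
  same binder shape, projected from ★ `unramifiedLocalConjDatum_adicCompletion` — so ONE currency serves both kinds of place.
* **`exists_cartan_antidiagonal_adicCompletion_of_ramified`** — the Cartan decomposition of `U(σ_w, J₀)(L_w)` relative to `K₀ = U ∩ GL_N(𝒪_w)` at every
  tamely ramified non-split place: `k₁ g k₂ = diag(d)` with `k₁, k₂ ∈ U(σ_w, J₀) ∩ glInt N L_w` and `σ_w(d_i) · d_{N-1-i} = 1` (★ F3 at the place; the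
  statement of ★ `cartanAntidiag` with `σ_w d = d` — impossible at a ramified place for non-unit `d` — replaced by the torus condition).

Consumers: the 13a road-A field-model heads ★ `K2E3WittCartanTameRamified.exists_unitaryInt_mul_noncommProd_wittCocharacter_mul_of_trace_norm` ∕
`isAdmissible_of_subsingleton_coinvariants_of_trace_norm` (crux H413, cell hodgecm-mathlib) instantiate at such a place in one line from the first
theorem.  HONEST LABEL: HC_CM is proved only modulo the 7 printed citations (2 remaining named inputs: hLiu418 = stmt-HodgeConjecture-24832,
h413 = stmt-HodgeConjecture-24833) until rung 0 closes; unconditional local algebra, count-neutral.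

References: J. Tits, *Reductive groups over local fields*, PSPUM 33.1 (1979), §3.3.3 [Tits1979]; J.-P. Serre, *Local Fields*, GTM 67 (1979), Ch. II §4
Prop. 7, Ch. V §3 (tame ⇔ unit different ⇔ surjective trace; unit norms) [Serre1979]; R. Jacobowitz, Amer. J. Math. 84 (1962), §8 [Jacobowitz1962].
-/

noncomputable section

open scoped Valued WithZero Matrix
open NumberField IsDedekindDomain

namespace Literature.NumberTheory.Automorphic.UnitaryGroup

open Literature.NumberTheory.Automorphic.HermitianLattice Literature.NumberTheory.Rogawski1990

/-! ## §1 The five binders at a tamely ramified, resp. unramified, non-split place -/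

/-- **(trace) + (norm) with an anti-fixed uniformiser at a TAMELY RAMIFIED non-split place of a CM field** (`e(w|v) ≠ 1`, `|2|_w = 1`): there is a
uniformiser `ϖ` of `L_w` with `σ_w ϖ = −ϖ`; `t = 2⁻¹` is integral with `t + σ_w t = 1`; every `σ_w`-fixed `u` with `|u − 1|_w < 1` is `z · σ_w z` with
`|z − 1|_w ≤ |u − 1|_w`.  (★ `Rogawski1990.ramifiedBlock_adicCompletion`.) [cite: Serre1979, Ch. V §3] [cite: Jacobowitz1962, §8] -/
theorem exists_traceNorm_adicCompletion_of_ramified (L : Type) [Field L] [NumberField L] [IsCMField L]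
    (v : HeightOneSpectrum (𝓞 ↥(maximalRealSubfield L))) (w : PlacesOver L v) (hw : IsCMField.complexConj L • w.1 = w.1)
    (he : v.asIdeal.ramificationIdx' w.1.asIdeal ≠ 1) (h2 : Valued.v (2 : w.1.adicCompletion L) = 1) :
    ∃ ϖ : w.1.adicCompletion L, Valued.v ϖ = WithZero.exp (-1 : ℤ) ∧
      galAdicCompletionMap (L := L) (IsCMField.complexConj L) hw ϖ = -ϖ ∧
      (∃ t : w.1.adicCompletion L, Valued.v t ≤ 1 ∧ t + galAdicCompletionMap (L := L) (IsCMField.complexConj L) hw t = 1) ∧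
      (∀ u : w.1.adicCompletion L, galAdicCompletionMap (L := L) (IsCMField.complexConj L) hw u = u → Valued.v (u - 1) < 1 →
        ∃ z : w.1.adicCompletion L, z * galAdicCompletionMap (L := L) (IsCMField.complexConj L) hw z = u ∧
          Valued.v (z - 1) ≤ Valued.v (u - 1)) := by
  obtain ⟨ϖ, hϖ, hσϖ, -, hnorm⟩ := ramifiedBlock_adicCompletion L v w hw he h2
  have h20 : (2 : w.1.adicCompletion L) ≠ 0 := fun h => by
    rw [h, map_zero] at h2
    exact zero_ne_one h2
  refine ⟨ϖ, hϖ, hσϖ, ⟨2⁻¹, ?_, ?_⟩, hnorm⟩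
  · rw [map_inv₀, h2, inv_one]
  · rw [map_inv₀, map_ofNat, ← two_mul, mul_inv_cancel₀ h20]

/-- **(trace) + (norm) at an UNRAMIFIED non-split place** of a quadratic extension `E ∕ F` of number fields (every residue characteristic), in the same
binder shape — the projection of ★ `unramifiedLocalConjDatum_adicCompletion` (whose uniformiser is even `σ_w`-fixed).
[cite: Serre1979, Ch. V §2 Prop. 3] [cite: Tits1979, §3.3.3] -/
theorem exists_traceNorm_adicCompletion_of_isUnramifiedIn {F E : Type} [Field F] [NumberField F] [Field E] [NumberField E] [Algebra F E]
    [Algebra.IsQuadraticExtension F E] (c : E ≃ₐ[F] E) (hc1 : c ≠ 1)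
    (v : HeightOneSpectrum (𝓞 F)) (w : PlacesOver E v) (hw : c • w.1 = w.1) (hv : Algebra.IsUnramifiedIn (𝓞 E) v.asIdeal) :
    ∃ ϖ : w.1.adicCompletion E, Valued.v ϖ = WithZero.exp (-1 : ℤ) ∧
      galAdicCompletionMap (L := E) c hw ϖ = ϖ ∧
      (∃ t : w.1.adicCompletion E, Valued.v t ≤ 1 ∧ t + galAdicCompletionMap (L := E) c hw t = 1) ∧
      (∀ u : w.1.adicCompletion E, galAdicCompletionMap (L := E) c hw u = u → Valued.v (u - 1) < 1 →
        ∃ z : w.1.adicCompletion E, z * galAdicCompletionMap (L := E) c hw z = u ∧ Valued.v (z - 1) ≤ Valued.v (u - 1)) := by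
  obtain ⟨ϖ, hd⟩ := unramifiedLocalConjDatum_adicCompletion c hc1 v w hw hv
  exact ⟨ϖ, hd.vϖ, hd.σϖ, hd.trace, hd.norm⟩

/-! ## §2 The Cartan decomposition of `U(σ_w, J₀)(L_w)` at a tamely ramified non-split place -/

/-- **Cartan decomposition of `U(σ_w, J₀)(L_w)` at a TAMELY RAMIFIED non-split place of a CM field** (`e(w|v) ≠ 1`, `|2|_w = 1`): for
`g ∈ U(σ_w, J₀)(L_w)` there are `k₁, k₂ ∈ U(σ_w, J₀) ∩ GL_N(𝒪_w)` and `d` with `σ_w(d_i) · d_{N-1-i} = 1` such that `k₁ g k₂ = diag(d)` — ★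
`exists_cartan_antidiagonal_of_trace_norm` fed with §1 and ★ `galAdicCompletionMap_galAdicCompletionMap_of_smul_eq` ∕ ★ `valued_galAdicCompletionMap`.
At a ramified place `K₀` is the stabiliser of the self-dual lattice `𝒪_w^N`, a special (not hyperspecial) maximal compact subgroup. [cite: Tits1979, §3.3.3] -/
theorem exists_cartan_antidiagonal_adicCompletion_of_ramified (L : Type) [Field L] [NumberField L] [IsCMField L] (N : ℕ)
    (v : HeightOneSpectrum (𝓞 ↥(maximalRealSubfield L))) (w : PlacesOver L v) (hw : IsCMField.complexConj L • w.1 = w.1)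
    (he : v.asIdeal.ramificationIdx' w.1.asIdeal ≠ 1) (h2 : Valued.v (2 : w.1.adicCompletion L) = 1)
    (g : GL (Fin N) (w.1.adicCompletion L))
    (hg : g ∈ unitaryGroupOfForm (galAdicCompletionMap (L := L) (IsCMField.complexConj L) hw)
      ((StdForm.antidiagonal N).over (w.1.adicCompletion L))) :
    ∃ k₁ k₂ : GL (Fin N) (w.1.adicCompletion L),
      k₁ ∈ unitaryGroupOfForm (galAdicCompletionMap (L := L) (IsCMField.complexConj L) hw)
          ((StdForm.antidiagonal N).over (w.1.adicCompletion L)) ∧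
      k₁ ∈ glInt N (w.1.adicCompletion L) ∧
      k₂ ∈ unitaryGroupOfForm (galAdicCompletionMap (L := L) (IsCMField.complexConj L) hw)
          ((StdForm.antidiagonal N).over (w.1.adicCompletion L)) ∧
      k₂ ∈ glInt N (w.1.adicCompletion L) ∧
      ∃ d : Fin N → w.1.adicCompletion L,
        ((k₁ * g * k₂ : GL (Fin N) (w.1.adicCompletion L)) : Matrix (Fin N) (Fin N) (w.1.adicCompletion L)) = Matrix.diagonal d ∧
          ∀ i, galAdicCompletionMap (L := L) (IsCMField.complexConj L) hw (d i) * d (Fin.rev i) = 1 := by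
  obtain ⟨ϖ, hϖ, -, htrace, hnorm⟩ := exists_traceNorm_adicCompletion_of_ramified L v w hw he h2
  have hσ : ∀ x, galAdicCompletionMap (L := L) (IsCMField.complexConj L) hw
      (galAdicCompletionMap (L := L) (IsCMField.complexConj L) hw x) = x :=
    galAdicCompletionMap_galAdicCompletionMap_of_smul_eq (IsCMField.complexConj L) w (IsCMField.complexConj_ne_one L) hw
  have hvσ : ∀ x, Valued.v (galAdicCompletionMap (L := L) (IsCMField.complexConj L) hw x) = Valued.v x :=
    fun x => valued_galAdicCompletionMap (L := L) (IsCMField.complexConj L) hw x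
  obtain ⟨k₁, k₂, hk₁U, hk₁i, hk₁i', hk₂U, hk₂i, hk₂i', d, hdiag, hdn⟩ :=
    exists_cartan_antidiagonal_of_trace_norm hσ hvσ hϖ htrace hnorm g hg
  have hglInt : ∀ k : GL (Fin N) (w.1.adicCompletion L),
      (∀ i j, Valued.v ((k : Matrix (Fin N) (Fin N) (w.1.adicCompletion L)) i j) ≤ 1) →
      (∀ i j, Valued.v (((k⁻¹ : GL (Fin N) (w.1.adicCompletion L)) :
        Matrix (Fin N) (Fin N) (w.1.adicCompletion L)) i j) ≤ 1) → k ∈ glInt N (w.1.adicCompletion L) := by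
    intro k hk hk'
    rw [mem_glInt_adicCompletion_iff]
    exact ⟨fun i j => (HeightOneSpectrum.mem_adicCompletionIntegers _ _ _).2 (hk i j),
      fun i j => (HeightOneSpectrum.mem_adicCompletionIntegers _ _ _).2 (hk' i j)⟩
  exact ⟨k₁, k₂, hk₁U, hglInt k₁ hk₁i hk₁i', hk₂U, hglInt k₂ hk₂i hk₂i', d, hdiag, hdn⟩

end Literature.NumberTheory.Automorphic.UnitaryGroup

end
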